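import Literature.Geometry.Kaehler.ComplexTorusGaloisCMTypeFamiliesIsogenyClasses
import Literature.NumberTheory.NumberFields.CyclotomicFieldsDegreeLeEightClassNumber
import HarnessLib

/-!
# «Isomorphic ⟺ isogenous ⟺ types in one family» for ALL complex tori of dimension `≤ 4` with an endomorphism of cyclotomic
# characteristic polynomial `Φ_d`, `d > 2` — uniformly in `d` (`h(ℚ(ζ_d)) = 1` for `φ(d) ≤ 8`)

Layer `Literature/Geometry/Kaehler`, namespace `Literature.Geometry.Kaehler.ComplexTorus`; lane `lit-hodgefound` (Track 2
foundations library), prover seat `lit-hodgefound-p10`, generation 33, row «A2-26(he)» (self-proposed 2026-08-28).  Theorems only;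
no `def`, no instance, no named fact (net Literature debt 0).

The tree's `isIsomorphic_periodIso_iff_isAutTransform` / `isIsomorphic_iff_isIsogenous_of_charpoly_eq_cyclotomic`
(`ComplexTorusGaloisCMTypeFamiliesIsogenyClasses`) ask `𝓞_{ℚ(ζ_d)}` principal; this generation's
`CyclotomicFieldsDegreeLeEightClassNumber` gives `h(ℚ(ζ_d)) = 1` for every `d > 2` with `φ(d) ≤ 8`.  Hence, with NO case
distinction on `d`:

* **`isIsomorphic_periodIso_iff_isAutTransform_of_totient_le_eight`**, `isIsomorphic_periodIso_iff_isIsogenous_of_totient_le_eight`: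
  for the models `ℂ^g/Φ(𝔞)` of any cyclotomic field of degree `≤ 8`, «isomorphic» ⟺ «isogenous» ⟺ «types in one
  `Aut`-family» (all ideals).
* **`isIsomorphic_iff_isIsogenous_of_charpoly_eq_cyclotomic_of_totient_le_eight`** and the dimension form
  **`isIsomorphic_iff_isIsogenous_of_charpoly_eq_cyclotomic_of_finrank_le_four`**: two complex tori of dimension `≤ 4` carrying
  endomorphisms with the same cyclotomic characteristic polynomial `Φ_d` (`d > 2`) are isomorphic iff they are isogenous; so the
  number of such tori up to isomorphism is the number of `Aut(ℚ(ζ_d))`-families of CM types of `ℚ(ζ_d)` (this generation's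
  censuses: `4, 4, 4, 5, 4` for `d = 15, 16, 20, 24, 30`).

## References

* [Shimura1998] G. Shimura, *Abelian Varieties with Complex Multiplication and Modular Functions* (1998), §6.1 Thm. 2
  p. 41, §7.4 Prop. 17 p. 58, §8.4 (2) p. 73.
* [BirkenhakeLange2004] Ch. Birkenhake, H. Lange, *Complex Abelian Varieties*, 2nd ed. (2004), §13.3.
* [Washington1997] L. C. Washington, *Introduction to Cyclotomic Fields*, 2nd ed. (1997), Thm. 11.1.
-/

noncomputable section

open scoped Classical nonZeroDivisors NumberField Manifold ContDiff MatrixGroups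
open NumberField Module Polynomial

namespace Literature.Geometry.Kaehler

namespace ComplexTorus

open Literature.AlgebraicGeometry.Motives (CMType)
open Literature.NumberTheory.ComplexMultiplication.CMTypeLattice (periodIso)
open Literature.AlgebraicGeometry.ComplexMultiplication.CyclotomicCMTypeResidueSets (IsAutTransform)
open Literature.NumberTheory.NumberFields (isPrincipalIdealRing_ringOfIntegers_of_isCyclotomicExtension_of_totient_le_eight)

/-! ### §1 The models `ℂ^g/Φ(𝔞)` of a cyclotomic field of degree `≤ 8` -/

section Models

variable {d : ℕ} {K : Type} [Field K] [NumberField K]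

/-- **`ℂ^g/Φ(𝔞) ≅ ℂ^g/Ψ(𝔟) ⟺ Φ, Ψ IN ONE FAMILY`, for ALL types and ideals of ANY cyclotomic field `ℚ(ζ_d)` of degree
`φ(d) ≤ 8`** (`d > 2`; `h(ℚ(ζ_d)) = 1`). [cite: Shimura1998, §7.4 Prop. 17 p. 58, §8.4 (2) p. 73] [cite: BirkenhakeLange2004, §13.3]
[cite: Washington1997, Thm. 11.1] -/
theorem isIsomorphic_periodIso_iff_isAutTransform_of_totient_le_eight (hK : IsCyclotomicExtension {d} ℚ K) (hd : 2 < d)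
    (h8 : Nat.totient d ≤ 8) (Φ Ψ : CMType K) (I J : (FractionalIdeal (𝓞 K)⁰ K)ˣ) :
    IsIsomorphic (periodIso Φ I) (periodIso Ψ J) ↔ IsAutTransform Φ Ψ := by
  haveI : NeZero d := ⟨by omega⟩
  haveI := isPrincipalIdealRing_ringOfIntegers_of_isCyclotomicExtension_of_totient_le_eight K hK hd h8
  obtain ⟨ζ, hζ⟩ : ∃ ζ : K, IsPrimitiveRoot ζ d :=
    IsCyclotomicExtension.exists_isPrimitiveRoot ℚ K (Set.mem_singleton d) (NeZero.ne d)
  exact isIsomorphic_periodIso_iff_isAutTransform hζ Φ Ψ I J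

/-- **… ⟺ `ℂ^g/Φ(𝔞) ∼ ℂ^g/Ψ(𝔟)`**: on the models of a cyclotomic field of degree `≤ 8` «isomorphic» and «isogenous» coincide.
[cite: Shimura1998, §6.1 Cor. p. 41, §7.4 Prop. 17 p. 58] [cite: BirkenhakeLange2004, §13.3] [cite: Washington1997, Thm. 11.1] -/
theorem isIsomorphic_periodIso_iff_isIsogenous_of_totient_le_eight (hK : IsCyclotomicExtension {d} ℚ K) (hd : 2 < d)
    (h8 : Nat.totient d ≤ 8) (Φ Ψ : CMType K) (I J : (FractionalIdeal (𝓞 K)⁰ K)ˣ) :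
    IsIsomorphic (periodIso Φ I) (periodIso Ψ J) ↔ IsIsogenous (periodIso Φ I) (periodIso Ψ J) := by
  haveI : NeZero d := ⟨by omega⟩
  haveI := isPrincipalIdealRing_ringOfIntegers_of_isCyclotomicExtension_of_totient_le_eight K hK hd h8
  obtain ⟨ζ, hζ⟩ : ∃ ζ : K, IsPrimitiveRoot ζ d :=
    IsCyclotomicExtension.exists_isPrimitiveRoot ℚ K (Set.mem_singleton d) (NeZero.ne d)
  exact isIsomorphic_periodIso_iff_isIsogenous hζ Φ Ψ I J

end Models

/-! ### §2 The pairs `(X, u)`, `P_u = Φ_d`, `φ(d) ≤ 8` -/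

section Tori

variable {ι : Type} [Fintype ι] [DecidableEq ι] {E : Type} [NormedAddCommGroup E] [NormedSpace ℂ E]
  {P : (ι → ℝ) ≃L[ℝ] E} {ι' : Type} [Fintype ι'] [DecidableEq ι'] {E' : Type} [NormedAddCommGroup E']
  [NormedSpace ℂ E'] {P' : (ι' → ℝ) ≃L[ℝ] E'} {d : ℕ}

set_option backward.isDefEq.respectTransparency false in -- Mathlib's instance
-- `IsCyclotomicExtension {d} ℚ (CyclotomicField d ℚ)` is keyed on `CyclotomicField.algebra`, the goal on
-- `DivisionRing.toRatAlgebra` (same workaround as `ComplexTorusCMTypeModelsHodgeClassesDegreeLeSix`)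
/-- **TWO COMPLEX TORI WITH ENDOMORPHISMS OF THE SAME CYCLOTOMIC CHARACTERISTIC POLYNOMIAL `Φ_d`, `d > 2`, `φ(d) ≤ 8`, ARE
ISOMORPHIC IFF THEY ARE ISOGENOUS** (`h(ℚ(ζ_d)) = 1`; uniformly in `d`). [cite: Shimura1998, §6.1 Thm. 2 p. 41, §7.4 Prop. 17 p. 58]
[cite: BirkenhakeLange2004, §13.3] [cite: Washington1997, Thm. 11.1] -/
theorem isIsomorphic_iff_isIsogenous_of_charpoly_eq_cyclotomic_of_totient_le_eight (hd : 2 < d) (h8 : Nat.totient d ≤ 8)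
    {A : Matrix ι ι ℤ} (hA : A ∈ endRingInt P) (hP : A.charpoly = cyclotomic d ℤ) {A' : Matrix ι' ι' ℤ}
    (hA' : A' ∈ endRingInt P') (hP' : A'.charpoly = cyclotomic d ℤ) : IsIsomorphic P P' ↔ IsIsogenous P P' := by
  haveI : NeZero d := ⟨by omega⟩
  haveI := isPrincipalIdealRing_ringOfIntegers_of_isCyclotomicExtension_of_totient_le_eight (CyclotomicField d ℚ)
    (CyclotomicField.isCyclotomicExtension d ℚ) hd h8
  exact isIsomorphic_iff_isIsogenous_of_charpoly_eq_cyclotomic (IsCyclotomicExtension.zeta_spec d ℚ (CyclotomicField d ℚ))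
    hA hP hA' hP'

/-- **THE SAME FOR COMPLEX TORI OF DIMENSION `≤ 4`** (`2 dim X = φ(d)`): two complex tori of dimension `≤ 4` with endomorphisms of
the same cyclotomic characteristic polynomial `Φ_d`, `d > 2`, are isomorphic iff they are isogenous.
[cite: Shimura1998, §6.1 Thm. 2 p. 41, §7.4 Prop. 17 p. 58] [cite: BirkenhakeLange2004, §13.3] [cite: Washington1997, Thm. 11.1] -/
theorem isIsomorphic_iff_isIsogenous_of_charpoly_eq_cyclotomic_of_finrank_le_four (hd : 2 < d) (h4 : finrank ℂ E ≤ 4)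
    {A : Matrix ι ι ℤ} (hA : A ∈ endRingInt P) (hP : A.charpoly = cyclotomic d ℤ) {A' : Matrix ι' ι' ℤ}
    (hA' : A' ∈ endRingInt P') (hP' : A'.charpoly = cyclotomic d ℤ) : IsIsomorphic P P' ↔ IsIsogenous P P' := by
  have h := two_mul_finrank_eq_totient_of_charpoly_eq_cyclotomic P hP
  exact isIsomorphic_iff_isIsogenous_of_charpoly_eq_cyclotomic_of_totient_le_eight hd (by omega) hA hP hA' hP'

end Tori

end ComplexTorus

end Literature.Geometry.Kaehler

end
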